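import Literature.Probability.LatticeModels.MeanFieldBoundProofs
import Literature.Probability.LatticeModels.PlusStateFKG
import Literature.Probability.LatticeModels.CriticalTwoPointLower
import Literature.Probability.LatticeModels.SusceptibilityMeanFieldBound
import HarnessLib

/-!
# The local Simon–Lieb inequality for the plus state, and why it cannot control the sign of the
# lattice Laplacian of the critical two-point function

Topic `Literature/Probability/LatticeModels`; family `crit-ising`. Theorem-only file (no named
fact, no sorry), written while grounding the cruxes
`Summit.CriticalPhenomena.Ising3DConformalLimit.Theses.PerfectScreening.SubharmonicOffOrigin`
(item stmt-CriticalPhenomena-1341: `6·G(x) ≤ Σᵢ (G(x+eᵢ) + G(x−eᵢ))` for `x ≠ 0`,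
`G = criticalTwoPoint 3`) and
`Summit.CriticalPhenomena.Ising3DConformalLimit.Theses.InverseSquareTelemetry.InverseSquareLaw`
(item stmt-CriticalPhenomena-4495), to record in one place the NEAREST KNOWN inequality and its
structural gap.

* `twoPointPlus_le_tanh_mul_sum_nbrs` — **the local Simon–Lieb inequality for the plus state**:
  for `β > 0` and `z ≠ 0`,
  `⟨σ₀σ_z⟩⁺_β ≤ tanh β · ∑ᵢ (⟨σ₀σ_{z-eᵢ}⟩⁺_β + ⟨σ₀σ_{z+eᵢ}⟩⁺_β)`.
  This is Duminil-Copin–Tassion's modified Simon inequality (CMP 343 (2016), Lemma 2.7;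
  PROVED in the tree for the plus state as `dct_modifiedSimon_holds`) at the one-point set
  `S = {0}`, where `⟨σ₀σ₀⟩_{S} = 1`; it is the original local inequality of Simon, CMP 77 (1980),
  Thm. (1.3) with Lieb's `tanh` improvement, CMP 77 (1980) 127, eq. (4).
* `criticalTwoPoint_le_tanh_mul_sum_nbrs` — the same at `β = β_c(d)` (`d ≥ 2`):
  `G(z) ≤ tanh β_c · ∑ᵢ (G(z-eᵢ) + G(z+eᵢ))`, i.e. the would-be subharmonicity
  `2d·G(z) ≤ ∑ᵢ (G(z+eᵢ) + G(z-eᵢ))` with the constant `1/(2d)` replaced by `tanh β_c(d)`.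
* `one_le_two_mul_mul_tanh_criticalBeta` — **the gap is structural**: `1 ≤ 2d · tanh β_c(d)`
  (`d ≥ 2`), from Duminil-Copin–Tassion's `φ_{β}(S) ≥ 1` for every finite `S ∋ 0` and `β ≥ β_c`
  (`one_le_dctIsingPhi_of_criticalBeta_le`, PROVED in the tree) at `S = {0}`, where
  `φ_β({0}) = 2d · tanh β` (`dctIsingPhi_singleton`). Hence `tanh β_c(d) ≥ 1/(2d)` and no
  Simon–Lieb/DCT-type bound can reach the constant `1/(2d)` needed for lattice subharmonicity of
  `G` off the origin: that sign is not decided by the known inequalities (it is conjectured in the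
  two routes above and left to Monte-Carlo falsification there).

References: B. Simon, CMP 77 (1980) 111–126; E. H. Lieb, CMP 77 (1980) 127–135;
H. Duminil-Copin, V. Tassion, CMP 343 (2016) 725–745, Lemma 2.7 and §2.1 (arXiv:1502.03050)
[DuminilCopinTassionCMP2016]; S. Friedli, Y. Velenik (2017), §3.10 [FriedliVelenik2017].

## Mathlib / tree status

Everything used is in the tree: `dct_modifiedSimon_holds` (MeanFieldBoundProofs.lean),
`plusPair_eq_twoPointPlus_sub` (PlusStateFKG.lean), `isingTwoPoint_self` (IsingModel.lean),
`neighborFinset_zdGraph_eq_image`, `single_signedUnit_injective`, `card_neighborFinset_zdGraph_holds` (LatticeGraph.lean; the neighbour-sum lemma is kept as a private local copy, the public one being `sum_neighborFinset_zdGraph` of LatticeLaplacianZd.lean), `criticalBeta_pos_holds`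
(CriticalTwoPointLower.lean), `one_le_dctIsingPhi_of_criticalBeta_le`
(SusceptibilityMeanFieldBound.lean), `dctIsingPhi_def` (SharpnessSubcritical.lean).
-/

noncomputable section

namespace Literature.Probability.LatticeModels

open Finset

variable {d : ℕ}

/-- Local copy of the neighbour-sum bookkeeping on `ℤ^d` (the tree's
`sum_neighborFinset_zdGraph`, LatticeLaplacianZd.lean): `∑_{y ∼ x} f y = ∑ᵢ (f (x + eᵢ) + f (x - eᵢ))`.
[folklore] -/
private theorem sum_nbrs_zd (f : Site d → ℝ) (x : Site d) :
    ∑ y ∈ (zdGraph d).neighborFinset x, f y =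
      ∑ i : Fin d, (f (x + Pi.single i 1) + f (x - Pi.single i 1)) := by
  classical
  have hf : Function.Injective
      fun p : Fin d × Bool => x + (Pi.single p.1 (if p.2 then 1 else -1) : Site d) :=
    fun p q h => single_signedUnit_injective (add_left_cancel h)
  rw [neighborFinset_zdGraph_eq_image, Finset.sum_image fun p _ q _ h => hf h,
    Fintype.sum_prod_type]
  refine Finset.sum_congr rfl fun i _ => ?_
  rw [Fintype.sum_bool]
  simp only [Bool.false_eq_true, if_true, if_false, Pi.single_neg, sub_eq_add_neg]

/-- **The local Simon–Lieb inequality for the plus state** (Simon, CMP 77 (1980), Thm., eq. (1.3),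
with Lieb's improvement, CMP 77 (1980) 127, eq. (4); here as the case `S = {0}` of
Duminil-Copin–Tassion's modified Simon inequality, CMP 343 (2016), Lemma 2.7, proved in the tree
as `dct_modifiedSimon_holds`): for the nearest-neighbour Ising model on `ℤ^d`, `β > 0` and
`z ≠ 0`, `⟨σ₀σ_z⟩⁺_β ≤ tanh β · ∑ᵢ (⟨σ₀σ_{z-eᵢ}⟩⁺_β + ⟨σ₀σ_{z+eᵢ}⟩⁺_β)`.
[cite: DuminilCopinTassionCMP2016, Lemma 2.7 (S = {0}), arXiv:1502.03050 numbering] [cite: Simon1980, Theorem, eq. (1.3)] -/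
theorem twoPointPlus_le_tanh_mul_sum_nbrs {β : ℝ} (hβ : 0 < β) {z : Site d} (hz : z ≠ 0) :
    twoPointPlus d β z ≤
      Real.tanh β * ∑ i : Fin d, (twoPointPlus d β (z - Pi.single i 1) + twoPointPlus d β (z + Pi.single i 1)) := by
  classical
  have h := dct_modifiedSimon_holds (d := d) hβ {0} (Finset.mem_singleton_self 0) z
    (by simpa using hz)
  rw [Finset.sum_singleton] at h
  have hfilter : ((zdGraph d).neighborFinset 0).filter (fun y => y ∉ ({0} : Finset (Site d))) =
      (zdGraph d).neighborFinset 0 := by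
    refine Finset.filter_true_of_mem fun y hy => ?_
    rw [Finset.mem_singleton]
    exact (((zdGraph d).mem_neighborFinset 0 y).1 hy).ne'
  rw [hfilter] at h
  simp_rw [isingTwoPoint_self, mul_one] at h
  rw [← Finset.mul_sum, sum_nbrs_zd (fun y => plusPair d β y z) 0] at h
  simpa [plusPair_eq_twoPointPlus_sub hβ.le, sub_neg_eq_add] using h

/-- **The local Simon–Lieb inequality at `β_c`** (`d ≥ 2`, where `β_c(d) > 0`,
`criticalBeta_pos_holds`): for `z ≠ 0`, `G(z) ≤ tanh β_c(d) · ∑ᵢ (G(z-eᵢ) + G(z+eᵢ))`,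
`G = criticalTwoPoint d = ⟨σ₀σ_·⟩⁺_{β_c,0}` — the nearest known relative of the conjectured lattice
subharmonicity `2d·G(z) ≤ ∑ᵢ (G(z+eᵢ) + G(z-eᵢ))` (route PerfectScreening, crux `SubH`), with
`1/(2d)` replaced by `tanh β_c(d) ≥ 1/(2d)` (`one_le_two_mul_mul_tanh_criticalBeta`).
[cite: Simon1980, Theorem, eq. (1.3)] [cite: DuminilCopinTassionCMP2016, Lemma 2.7 (S = {0})] -/
theorem criticalTwoPoint_le_tanh_mul_sum_nbrs (hd : 2 ≤ d) {z : Site d} (hz : z ≠ 0) :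
    criticalTwoPoint d z ≤
      Real.tanh (criticalBeta d) *
        ∑ i : Fin d, (criticalTwoPoint d (z - Pi.single i 1) + criticalTwoPoint d (z + Pi.single i 1)) :=
  twoPointPlus_le_tanh_mul_sum_nbrs (criticalBeta_pos_holds hd) hz

/-- `φ_β({0}) = 2d · tanh β` for Duminil-Copin–Tassion's boundary functional at the one-point set
(CMP 343 (2016), eq. (2.1): the inner sum runs over the `2d` neighbours of `0`, and
`⟨σ₀σ₀⟩_{{0}} = 1`). [cite: DuminilCopinTassionCMP2016, eq. (2.1), §2.1 (S = {0})] -/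
theorem dctIsingPhi_singleton (β : ℝ) : dctIsingPhi d β {0} = 2 * d * Real.tanh β := by
  classical
  have hfilter : ((zdGraph d).neighborFinset 0).filter (fun y => y ∉ ({0} : Finset (Site d))) =
      (zdGraph d).neighborFinset 0 := by
    refine Finset.filter_true_of_mem fun y hy => ?_
    rw [Finset.mem_singleton]
    exact (((zdGraph d).mem_neighborFinset 0 y).1 hy).ne'
  rw [dctIsingPhi_def, Finset.sum_singleton, hfilter, Finset.sum_const, nsmul_eq_mul,
    isingTwoPoint_self, mul_one, card_neighborFinset_zdGraph_holds 0]
  push_cast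
  ring

/-- **The gap is structural: `1 ≤ 2d · tanh β_c(d)`** (`d ≥ 2`). Duminil-Copin–Tassion, CMP 343
(2016), §2.1: `β_c = sup{β : φ_β(S) < 1 for some finite S ∋ 0}` (`β̃_c = β_c`), so `φ_β(S) ≥ 1`
for every finite `S ∋ 0` and `β ≥ β_c` (tree: `one_le_dctIsingPhi_of_criticalBeta_le`); at
`S = {0}` this reads `2d · tanh β_c ≥ 1`. Consequently the local Simon–Lieb inequality at `β_c`
(`criticalTwoPoint_le_tanh_mul_sum_nbrs`) is WEAKER than the averaging inequality
`G(z) ≤ (2d)⁻¹ ∑_{y∼z} G(y)` by the factor `2d·tanh β_c(d) ≥ 1` (`≈ 1.31` for `d = 3`), and cannot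
decide the sign of the lattice Laplacian of `G` off the origin.
[cite: DuminilCopinTassionCMP2016, Thm. 1.2 / §2.1 (β̃_c = β_c; φ_{β}(S) ≥ 1 for β ≥ β_c)] -/
theorem one_le_two_mul_mul_tanh_criticalBeta (hd : 2 ≤ d) :
    1 ≤ 2 * d * Real.tanh (criticalBeta d) := by
  rw [← dctIsingPhi_singleton]
  exact one_le_dctIsingPhi_of_criticalBeta_le hd le_rfl {0} (Finset.mem_singleton_self 0)

end Literature.Probability.LatticeModels
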